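import Mathlib
import HarnessLib

/-!
# The delete-one-replica JACKKNIFE error of a replica mean IS the replica-`t` error: `((R−1)/R) Σ_r (ȳ_{(−r)} − ȳ)² = Σ_r (y_r − ȳ)² / (R(R−1))` exactly

HONEST FRAMING: exact (Metropolis-corrected) sampling algorithms for lattice gauge theory;
figures of merit are autocorrelation/cost numbers at stated couplings and volumes; no
continuum-physics claim.

Venture `LatticeQCDFlow` (cell pub-lqcd), topic `Exactness`; FANOUT row 13 (`eng-snf`, GEN-24).  NEW
WORK of the cell against Mathlib only (finite sums); textbook algebra (Quenouille–Tukey jackknife,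
NAMED ONLY); no definition is introduced; nothing is cited as a fact.

WHY (row 13).  GEN-23/24 state every replica error bar of the engine as the replica-`t` statistic
`(ȳ − θ) / √(Σ_r (y_r − ȳ)² / (R(R−1)))` of the `R` per-replica estimates `y_r`
(`NCMCGeneralSpaceReplicaTStatistic` and its descendants) and gloss it as the "replica / jackknife
bar".  For the replica MEAN the gloss is an identity, proved here once: deleting replica `r` gives the
leave-one-out mean `ȳ_{(−r)} = (Σ_{s≠r} y_s)/(R−1)`, the jackknife pseudo-mean of these is `ȳ` itself,
and the jackknife variance `((R−1)/R) Σ_r (ȳ_{(−r)} − ȳ)²` equals the replica-`t` variance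
`Σ_r (y_r − ȳ)²/(R(R−1))` EXACTLY — so the delete-one-replica jackknife interval of a replica mean and
the replica-`t` interval are the same interval, and every coverage statement about one is a statement
about the other.

## Content
* `sum_univ_erase_eq_sum_sub` (§1) — `Σ_{s≠r} y_s = Σ_s y_s − y_r`;
  **`leaveOneOut_mean_sub_mean`** — `R ≥ 2`: `ȳ_{(−r)} − ȳ = (ȳ − y_r)/(R − 1)`;
  **`mean_leaveOneOut_mean`** — `(1/R) Σ_r ȳ_{(−r)} = ȳ`.
* **`jackknife_variance_mean_eq`** (§2) — `R ≥ 2`: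
  `((R−1)/R) Σ_r (ȳ_{(−r)} − ȳ)² = (Σ_r (y_r − ȳ)²) / (R(R−1))`;
  **`jackknife_tStat_eq_tStat`** — the studentised deviations coincide:
  `(ȳ − θ)/√(jackknife variance) = (ȳ − θ)/√(Σ_r (y_r − ȳ)²/(R(R−1)))`;
  **`setOf_abs_sub_le_mul_sqrt_jackknife_eq`** — for replica estimates `Y : Ω → ι → ℝ` the
  acceptance events `{|Ȳ − θ| ≤ q·ŝe_JK}` and `{|Ȳ − θ| ≤ q·ŝe_t}` are the same set (so every
  probability / coverage statement transfers verbatim).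

NOT CLAIMED: NONLINEAR statistics — for the delete-one-replica jackknife of a POOLED nonlinear
estimator (Jarzynski's `−log`, reweighting ratios, Bennett roots) the two variances agree only
asymptotically (delta method), which is not proved here; the block / binning jackknife WITHIN one
chain; bias correction.
-/

namespace Summit.Ventures.LatticeQCDFlow.Exactness.GeneralNCMC

open Finset

section Jackknife

variable {ι : Type*} [Fintype ι] [DecidableEq ι]

/-! ## §1 Leave-one-out means -/

/-- `Σ_{s ≠ r} y_s = Σ_s y_s − y_r`. -/
theorem sum_univ_erase_eq_sum_sub (y : ι → ℝ) (r : ι) :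
    ∑ s ∈ univ.erase r, y s = (∑ s, y s) - y r := by
  rw [sum_erase_eq_sub (mem_univ r)]

/-- **Leave-one-out mean minus the mean**: for `R = card ι ≥ 2`,
`(Σ_{s≠r} y_s)/(R−1) − ȳ = (ȳ − y_r)/(R−1)`. -/
theorem leaveOneOut_mean_sub_mean (y : ι → ℝ) (hR : 2 ≤ Fintype.card ι) (r : ι) :
    (∑ s ∈ univ.erase r, y s) / (Fintype.card ι - 1) - (∑ s, y s) / Fintype.card ι
      = ((∑ s, y s) / Fintype.card ι - y r) / (Fintype.card ι - 1) := by
  have hR0 : (Fintype.card ι : ℝ) ≠ 0 := by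
    have : (2 : ℝ) ≤ Fintype.card ι := by exact_mod_cast hR
    positivity
  have hR1 : (Fintype.card ι : ℝ) - 1 ≠ 0 := by
    have : (2 : ℝ) ≤ Fintype.card ι := by exact_mod_cast hR
    linarith
  rw [sum_univ_erase_eq_sum_sub]
  field_simp
  ring

/-- **The jackknife pseudo-mean of a mean is the mean**: `(1/R) Σ_r ȳ_{(−r)} = ȳ` (`R ≥ 2`). -/
theorem mean_leaveOneOut_mean (y : ι → ℝ) (hR : 2 ≤ Fintype.card ι) :
    (∑ r, (∑ s ∈ univ.erase r, y s) / (Fintype.card ι - 1)) / Fintype.card ι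
      = (∑ s, y s) / Fintype.card ι := by
  have hR1 : (Fintype.card ι : ℝ) - 1 ≠ 0 := by
    have : (2 : ℝ) ≤ Fintype.card ι := by exact_mod_cast hR
    linarith
  congr 1
  simp_rw [sum_univ_erase_eq_sum_sub]
  rw [← sum_div, sum_sub_distrib, sum_const, card_univ, nsmul_eq_mul]
  field_simp

/-! ## §2 The jackknife variance of a mean equals the replica-`t` variance -/

/-- **JACKKNIFE VARIANCE = REPLICA-`t` VARIANCE (exactly, for means)**: for `R = card ι ≥ 2`,
`((R−1)/R) Σ_r (ȳ_{(−r)} − ȳ)² = (Σ_r (y_r − ȳ)²) / (R(R−1))`. -/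
theorem jackknife_variance_mean_eq (y : ι → ℝ) (hR : 2 ≤ Fintype.card ι) :
    (Fintype.card ι - 1) / Fintype.card ι
        * ∑ r, ((∑ s ∈ univ.erase r, y s) / (Fintype.card ι - 1) - (∑ s, y s) / Fintype.card ι) ^ 2
      = (∑ r, (y r - (∑ s, y s) / Fintype.card ι) ^ 2)
          / ((Fintype.card ι : ℝ) * (Fintype.card ι - 1)) := by
  have hR0 : (Fintype.card ι : ℝ) ≠ 0 := by
    have : (2 : ℝ) ≤ Fintype.card ι := by exact_mod_cast hR
    positivity
  have hR1 : (Fintype.card ι : ℝ) - 1 ≠ 0 := by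
    have : (2 : ℝ) ≤ Fintype.card ι := by exact_mod_cast hR
    linarith
  simp_rw [leaveOneOut_mean_sub_mean y hR, div_pow]
  rw [← sum_div]
  have hsq : ∀ r, ((∑ s, y s) / Fintype.card ι - y r) ^ 2 = (y r - (∑ s, y s) / Fintype.card ι) ^ 2 :=
    fun r => by ring
  simp_rw [hsq]
  field_simp

/-- **The jackknife-studentised deviation IS the replica-`t` statistic** (means, `R ≥ 2`). -/
theorem jackknife_tStat_eq_tStat (y : ι → ℝ) (hR : 2 ≤ Fintype.card ι) (θ : ℝ) :
    ((∑ s, y s) / Fintype.card ι - θ)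
        / Real.sqrt ((Fintype.card ι - 1) / Fintype.card ι
            * ∑ r, ((∑ s ∈ univ.erase r, y s) / (Fintype.card ι - 1)
                - (∑ s, y s) / Fintype.card ι) ^ 2)
      = ((∑ s, y s) / Fintype.card ι - θ)
        / Real.sqrt ((∑ r, (y r - (∑ s, y s) / Fintype.card ι) ^ 2)
            / ((Fintype.card ι : ℝ) * (Fintype.card ι - 1))) := by
  rw [jackknife_variance_mean_eq y hR]

/-- **Same acceptance event**: for replica estimates `Y : Ω → ι → ℝ`, a centre `θ` and a quantile
`q`, the delete-one-replica jackknife bar and the replica-`t` bar accept on the same set of outcomes —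
so every probability, limit or coverage statement about one (GEN-23/24: limiting coverage `L_R(q)`)
is verbatim a statement about the other. -/
theorem setOf_abs_sub_le_mul_sqrt_jackknife_eq {Ω : Type*} (Y : Ω → ι → ℝ)
    (hR : 2 ≤ Fintype.card ι) (θ q : ℝ) :
    {ω | |(∑ s, Y ω s) / Fintype.card ι - θ|
        ≤ q * Real.sqrt ((Fintype.card ι - 1) / Fintype.card ι
            * ∑ r, ((∑ s ∈ univ.erase r, Y ω s) / (Fintype.card ι - 1)
                - (∑ s, Y ω s) / Fintype.card ι) ^ 2)}
      = {ω | |(∑ s, Y ω s) / Fintype.card ι - θ|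
        ≤ q * Real.sqrt ((∑ r, (Y ω r - (∑ s, Y ω s) / Fintype.card ι) ^ 2)
            / ((Fintype.card ι : ℝ) * (Fintype.card ι - 1)))} := by
  ext ω
  simp only [Set.mem_setOf_eq, jackknife_variance_mean_eq (Y ω) hR]

end Jackknife

end Summit.Ventures.LatticeQCDFlow.Exactness.GeneralNCMC
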